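import Summits.BirchSwinnertonDyer.Rank1Residual.O6.LocalTowerLaws
import HarnessLib

/-!
# BSD rank-≤1 residual cell, class O6 (WILD `p = 3`), Iwasawa side: the Ш-GROWTH DICTIONARY — law (G)
# `e_n = α·3^n + β + γ·n + δ·(−1)^n` with `α = ℓ(τ) − v₃(Δ_min)/12` is a THEOREM given STAB + the local tower laws
# (F), (D), (C) + the 3-BSD bookkeeping over `k_n` (a hypothesis SCHEMA, never asserted); plus the Kurihara–Pollack
# exponent `u_n` (Pollack 2005 Thm 1.1 at `p = 3`, closed form PROVED). THEOREMS and arithmetic only — no new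
# conjecture node; (G) is deliberately NOT typed as an independent node (o6-r1 GEN 15 memo §2.3).

HONEST FRAMING (cell `b2b-bsdres`, run/shared/lean/b2b/bsd-rank1-residual/, verbatim in every file): the goal of
the cell is to DELETE the COMBINATION-SHAPED residual classes of the Birch–Swinnerton-Dyer formula for ALL
analytic-rank `≤ 1` elliptic curves over `ℚ` — assembled STRICTLY from published theorems — so that the rank-`≤ 1`
remainder becomes exactly the CONSTRUCTION-SHAPED classes, which are TYPED (missing-input `Prop`s), NOT attempted.
This is not "finishing BSD". Lane CLASS-CLOSURE (`CLASS-CLOSURE-PLAN.md` §3.4 O6, deliverable (b): the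
VERBATIM-EXTENSION part handed to provers — "(c) the dictionary lemma of §2.3 (elementary: telescoping `S_k`) so that
`UnitRowsLaw` / `LambdaTypeLawAbelian` shells can cite STAB instead of carrying their own growth terms"): research routes;
no claim beyond the stated classes; census output is EVIDENCE, never a Literature fact; no main conjecture and no `p`-adic
`L`-function is assumed; BSD over the layers `k_n` enters ONLY as the explicit hypothesis schema `ThreeBSDTowerBookkeeping`;
nothing is booked; no mark of `RESIDUAL-MAP.md` moves; O6 stays OPEN. 0 Literature facts are minted here.

## What is proved (cc-typer-5 GEN 11 = O5/O6 typer of record; ask (ii) of o6-r1 GEN 15, `HOME/INBOX.md` 2026-08-22T00:10Z /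
## 00:31Z, `cells/o5o6/TARGETS.md` §O6 (G15-2), (G15-5) "`ShaGrowthDictionary` (§2.3) as a theorem over the interfaces";
## content = memo `HOME/b2b-bsdres-o6-r1/gen15/O6-GEN15.md` §0 (ii), §2.1–§2.3; instruments `gen15/kur/alpha15.py`,
## `strata15.py`, `bsd3_isl_k6_v15.txt`; placement / names / dedup = class typer)

* §1 ARITHMETIC: the Kurihara–Pollack exponent `u_n` (`kpExponent`: `u_0 = u_1 = 0`, `u_{n+2} = u_n + 3^{n+1} − 1`;
  `0, 0, 2, 8, 28, 88, 270`; closed form `(3^{n+1} + (−1)^n)/8 − (n+1)/2` PROVED = Pollack 2005 Thm 1.1's `e_n` at `p = 3`,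
  the calibration sequence of the type baselines of memo §2.1: `E_n(3,II) = 2u_{n−1} = (3^n − (−1)^n)/4 − n`, PROVED as
  arithmetic); `φ(3^k) = (2/3)·3^k`; the alternating sum `σ(n) = Σ_{k=1}^{n}(−1)^k`.
* §2 THE DICTIONARY (memo §2.3) — THEOREMS: (i) `shaGrowthDictionary`, the telescoping identity: if `e_k − e_{k−1} =
  φ(3^k)ν_k − (d_k − d_{k−1}) − (c_k − c_{k−1}) − r` and `φ(3^k)ν_k = A·3^k + b + q·(−1)^k` for `k ≥ k₀`, then
  `e_n + d_n + c_n − (3A/2)·3^n − (b − r)·n − q·σ(n)` is CONSTANT in `n ≥ k₀ − 1`; (ii) `shaGrowth_fourParameter`: with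
  `d_n = (3^n v − v_n)/12` and `v_n`, `c_n` 2-periodic from `n = 1` (laws (D), (C)), `e_n = (3A/2 − v/12)·3^n + (b − r)·n +
  β + δ·(−1)^n` (`n ≥ k₀`); (iii) the RATE TABLE: `3A/2 = ℓ`, `ℓ + 1/8`, `ℓ + 1/2` for STAB's `A = 2ℓ/3` (reducible:
  `α = μ_w(τ)`), the exploratory IRR shell `A = 2ℓ/3 + 1/12` (`α = μ_w + 1/8`), the `j = 0` shell `A = 2ℓ/3 + 1/3`
  (`α = μ_w + 1/2`) — memo §2.3's "12/12 + 2/2 rates" mechanism; `rate_classB_values` (`μ_w` on the cyclic class);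
  (iv) `shaGrowthLaw_of_stability_of_towerLaws` (over the interfaces): for a 3-surjective, locally reducible, `j ≠ 0`
  curve `W ∈ O6`, STAB (`AnalyticStabilityLawThree`, sibling `O6/KatoLocalFloorAnalytic.lean`) + (F) + (D) + (C)
  (`O6/LocalTowerLaws.lean`) + `ThreeBSDTowerBookkeeping` (the per-layer quotient of the 3-parts of BSD(`W/k_k`) and
  BSD(`W/k_{k−1}`) in o6-r1's normalisation, memo §1 COROLLARY `S_k := φ(3^k)ν⁺_k − Δd_k − Δord₃c_k − rank`, as a
  HYPOTHESIS) ⟹ law (G) with `α = ℓ(v₃N, Kod₃) − v₃(Δ_min)/12` EXACTLY and `γ = b⁺ − r` — so memo §2.2's fitted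
  `α = μ_w(τ)` on every locally reducible curve (100 %) carries no conjecture beyond STAB and the local laws.

NOT typed here (memo §5 / §2.3, "exploratory shells, NOT conjecture-grade"): the IRR step form and the E-ISOG one-sign form
of STAB (their rates appear only in the proved rate table); the baselines `E_n(τ)` as census values (EVIDENCE; recorded in
`class-closure/O6/TYPED.md` §16). DEDUP (`lean search` / tree grep: `kpExponent`, `altSignSum`, `shaGrowthDictionary`,
`shaGrowth_fourParameter`, `ThreeBSDTowerBookkeeping`, `analyticPos_eq_of_stability`, …): no match. Reused by name:
`phiThree`, `cellLevel`, `newPoleOrder`, `SignedFloorDatum`, `analyticPos`, `AnalyticStabilityLawThree`, `LocalTowerDatum`,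
the three tower laws, `valDiscAt_add_two_eq`, `condExpAt_add_two_eq`.

References: R. Pollack, J. Number Theory 110 (2005) 164–177, Thm. 1.1 (`e_n`), §5 (`e_n = e_{n−1} + q_n`) [Pollack2005];
M. Kurihara, Invent. Math. 149 (2002) Thm. 0.1 / Prop. 1.2 [Kurihara2002]; B. Mazur, J. Tate, Duke Math. J. 54 (1987) §1
[MazurTate1987]; census: o6-r1 GEN 15 `gen15/kur/alpha15.py` (law (G) 283/285 island curves), `bsd3_isl_k6_v15.txt`
(1 232/1 232 steps), P-AN5-STAB (sibling file).
-/

set_option autoImplicit false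

noncomputable section

open scoped Classical

open WeierstrassCurve Literature.NumberTheory.EllipticCurves
  Literature.NumberTheory.EllipticCurves.Rank1Residual
  Literature.NumberTheory.EllipticCurves.Rank1Residual.Typed
  Summit.BirchSwinnertonDyer.Rank1Residual.Additive

open Literature.NumberTheory.DiophantineGeometry (KodairaSymbol)

namespace Summit.BirchSwinnertonDyer.Rank1Residual.O6

/-! ## §1 Pure arithmetic: the Kurihara–Pollack exponent `u_n`, `φ(3^k) = (2/3)·3^k`, the alternating sum -/

/-- **The Kurihara–Pollack exponent `u_n` at `p = 3`** (memo §0 (ii), §2.1: `u_n := (3^{n+1} + (−1)^n)/8 − (n+1)/2 =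
0, 0, 2, 8, 28, 88, 270` "= Kurihara–Pollack's `e_n` at `p = 3`"), defined by the recursion `u_0 = u_1 = 0`,
`u_{n+2} = u_n + 3^{n+1} − 1`; the closed form is `kpExponent_closedForm`. It is Pollack's `e_n` of Thm. 1.1
(`p^{n−1} + p^{n−3} + ⋯ + p − n/2` for even `n ≥ 2`, `p^{n−1} + ⋯ + p² − (n−1)/2` for odd `n ≥ 3`) at `p = 3`: the
`3`-adic order of `#Ш(E/ℚ_n)` for a GOOD supersingular `3` under his hypotheses — the calibration sequence the wild
type baselines of memo §2.1 are built from (`E_n(3,II) = 2u_{n−1}`, …; (3,II) IRR rank 1: `e_n = u_n` exactly).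
[cite: Pollack2005, Thm. 1.1] -/
def kpExponent : ℕ → ℕ
  | 0 => 0
  | 1 => 0
  | n + 2 => kpExponent n + (3 ^ (n + 1) - 1)

/-- `u_0, …, u_6 = 0, 0, 2, 8, 28, 88, 270`. [cite: Pollack2005, Thm. 1.1] -/
theorem kpExponent_values :
    kpExponent 0 = 0 ∧ kpExponent 1 = 0 ∧ kpExponent 2 = 2 ∧ kpExponent 3 = 8 ∧ kpExponent 4 = 28 ∧
      kpExponent 5 = 88 ∧ kpExponent 6 = 270 := by
  decide

/-- **Closed form** `u_n = (3^{n+1} + (−1)^n)/8 − (n+1)/2` (PROVED from the recursion). [cite: Pollack2005, Thm. 1.1] -/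
theorem kpExponent_closedForm : ∀ n : ℕ,
    (kpExponent n : ℚ) = ((3 : ℚ) ^ (n + 1) + (-1) ^ n) / 8 - ((n : ℚ) + 1) / 2
  | 0 => by norm_num [kpExponent]
  | 1 => by norm_num [kpExponent]
  | n + 2 => by
      have ih := kpExponent_closedForm n
      have h1 : 1 ≤ 3 ^ (n + 1) := Nat.one_le_pow _ _ (by norm_num)
      rw [kpExponent, Nat.cast_add, Nat.cast_sub h1, ih]
      push_cast
      ring

/-- `2·u_{n−1} = (3^n − (−1)^n)/4 − n` (`n ≥ 1`) — the common type baseline `E_n(3,II) = E_n(3,IV*) = E_n(5,II) = 2u_{n−1}`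
of memo §2.1 in closed form (the baseline VALUES are census EVIDENCE and are not typed; this is only the arithmetic of the
closed form). [folklore] -/
theorem two_mul_kpExponent_pred (n : ℕ) (hn : 1 ≤ n) :
    2 * (kpExponent (n - 1) : ℚ) = ((3 : ℚ) ^ n - (-1) ^ n) / 4 - n := by
  obtain ⟨m, rfl⟩ : ∃ m, n = m + 1 := ⟨n - 1, by omega⟩
  rw [Nat.add_sub_cancel, kpExponent_closedForm]
  push_cast
  ring

/-- `φ(3^k) = (2/3)·3^k` for `k ≥ 1` (so `φ(3^k)·ℓ = (2ℓ/3)·3^k`, the shape of STAB's closed form). [folklore] -/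
theorem phiThree_eq_two_thirds_mul (k : ℕ) (hk : 1 ≤ k) : (phiThree k : ℚ) = 2 / 3 * 3 ^ k := by
  obtain ⟨m, rfl⟩ : ∃ m, k = m + 1 := ⟨k - 1, by omega⟩
  simp only [phiThree, Nat.add_sub_cancel]
  push_cast
  ring

/-! ## §2 The Ш-growth DICTIONARY (memo §2.3) — theorems; the only conjectural inputs are the NAMED hypotheses -/

/-- `σ(n) := Σ_{k=1}^{n} (−1)^k = ((−1)^n − 1)/2 ∈ {−1, 0}` — the bounded 2-periodic primitive of `(−1)^k`. [folklore] -/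
def altSignSum (n : ℕ) : ℚ := ((-1 : ℚ) ^ n - 1) / 2

/-- `σ(n+1) = σ(n) + (−1)^{n+1}`. [folklore] -/
theorem altSignSum_succ (n : ℕ) : altSignSum (n + 1) = altSignSum n + (-1) ^ (n + 1) := by
  unfold altSignSum
  ring

/-- `σ(n+2) = σ(n)`. [folklore] -/
theorem altSignSum_add_two (n : ℕ) : altSignSum (n + 2) = altSignSum n := by
  unfold altSignSum
  ring

/-- **THE DICTIONARY, telescoping form (memo §2.3, PROVED).** Let `e, ν, d, c : ℕ → ℚ`, `r, A, b, q ∈ ℚ`, `k₀ ≥ 1`. If for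
every `k ≥ k₀` the LAYER STEP `e_k − e_{k−1} = φ(3^k)·ν_k − (d_k − d_{k−1}) − (c_k − c_{k−1}) − r` holds (memo §1 COROLLARY:
`S_k = e_k − e_{k−1}` with `S_k := φ(3^k)ν⁺_k − Δd_k − Δord₃c_k − rank`) and the analytic valuations have the CLOSED FORM
`φ(3^k)·ν_k = A·3^k + b + q·(−1)^k` (STAB: `A = 2ℓ/3`, `q = 0`; the exploratory IRR / `j = 0` shells: `A = 2ℓ/3 + 1/12`
resp. `+ 1/3`, `q = c`), then the quantity `e_n + d_n + c_n − (3A/2)·3^n − (b − r)·n − q·σ(n)` does not depend on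
`n ≥ k₀ − 1` — "summing over `k ≤ n`: `Σ A·3^k` gives the rate `3A/2`, `Σ Δd_k = d_n`, `Σ Δc_k = c_n`, the constant `b`
gives the linear term". [folklore] -/
theorem shaGrowthDictionary (e ν d c : ℕ → ℚ) (r A b q : ℚ) (k₀ : ℕ) (hk₀ : 1 ≤ k₀)
    (hstep : ∀ k, k₀ ≤ k →
      e k - e (k - 1) = (phiThree k : ℚ) * ν k - (d k - d (k - 1)) - (c k - c (k - 1)) - r)
    (hstab : ∀ k, k₀ ≤ k → (phiThree k : ℚ) * ν k = A * 3 ^ k + b + q * (-1) ^ k) :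
    ∀ n, k₀ - 1 ≤ n →
      e n + d n + c n - 3 * A / 2 * 3 ^ n - (b - r) * n - q * altSignSum n =
        e (k₀ - 1) + d (k₀ - 1) + c (k₀ - 1) - 3 * A / 2 * 3 ^ (k₀ - 1) - (b - r) * ((k₀ - 1 : ℕ) : ℚ) -
          q * altSignSum (k₀ - 1) := by
  intro n hn
  induction n, hn using Nat.le_induction with
  | base => rfl
  | succ n hn ih =>
      have hk : k₀ ≤ n + 1 := by omega
      have hs := hstep (n + 1) hk
      have ht := hstab (n + 1) hk
      rw [Nat.add_sub_cancel] at hs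
      rw [altSignSum_succ]
      push_cast
      linear_combination ih + hs + ht

/-- A function that is 2-periodic from `n = 1` on is `β + δ·(−1)^n` there. [folklore] -/
theorem exists_eq_add_mul_neg_one_pow_of_periodic (p : ℕ → ℚ) (hp : ∀ n, 1 ≤ n → p (n + 2) = p n) :
    ∃ β δ : ℚ, ∀ n, 1 ≤ n → p n = β + δ * (-1) ^ n := by
  refine ⟨(p 2 + p 1) / 2, (p 2 - p 1) / 2, ?_⟩
  -- strengthened two-layer statement
  have key : ∀ m : ℕ, p (m + 1) = (p 2 + p 1) / 2 + (p 2 - p 1) / 2 * (-1) ^ (m + 1) ∧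
      p (m + 2) = (p 2 + p 1) / 2 + (p 2 - p 1) / 2 * (-1) ^ (m + 2) := by
    intro m
    induction m with
    | zero => constructor <;> ring
    | succ m ih =>
        refine ⟨ih.2, ?_⟩
        rw [hp (m + 1) (by omega), ih.1]
        ring
  intro n hn
  obtain ⟨m, rfl⟩ : ∃ m, n = m + 1 := ⟨n - 1, by omega⟩
  exact (key m).1

/-- **THE DICTIONARY, four-parameter form = law (G) (memo §2.2–2.3, PROVED):** under the layer step and the closed form of
`shaGrowthDictionary`, with `d_n = (3^n·v − v_n)/12` for a sequence `v_n` that is 2-periodic from `n = 1` (law (D)) and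
`c_n` 2-periodic from `n = 1` (law (C)), there are constants `β, δ` with
`e_n = (3A/2 − v/12)·3^n + (b − r)·n + β + δ·(−1)^n` for all `n ≥ k₀` — the RATE is `α = 3A/2 − v/12`, the LINEAR
coefficient is `γ = b − r`, and the 2-periodic inputs only move `β, δ`. [folklore] -/
theorem shaGrowth_fourParameter (e ν c : ℕ → ℚ) (vv : ℕ → ℕ) (v : ℕ) (r A b q : ℚ) (k₀ : ℕ) (hk₀ : 1 ≤ k₀)
    (d : ℕ → ℚ) (hd : ∀ n, d n = ((3 : ℚ) ^ n * v - vv n) / 12)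
    (hvv : ∀ n, 1 ≤ n → vv (n + 2) = vv n) (hc : ∀ n, 1 ≤ n → c (n + 2) = c n)
    (hstep : ∀ k, k₀ ≤ k →
      e k - e (k - 1) = (phiThree k : ℚ) * ν k - (d k - d (k - 1)) - (c k - c (k - 1)) - r)
    (hstab : ∀ k, k₀ ≤ k → (phiThree k : ℚ) * ν k = A * 3 ^ k + b + q * (-1) ^ k) :
    ∃ β δ : ℚ, ∀ n, k₀ ≤ n → e n = (3 * A / 2 - (v : ℚ) / 12) * 3 ^ n + (b - r) * n + β + δ * (-1) ^ n := by
  -- the constant of the telescoping identity (opaque)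
  obtain ⟨C₀, hC⟩ : ∃ C₀ : ℚ, ∀ n, k₀ - 1 ≤ n →
      e n + d n + c n - 3 * A / 2 * 3 ^ n - (b - r) * n - q * altSignSum n = C₀ :=
    ⟨_, shaGrowthDictionary e ν d c r A b q k₀ hk₀ hstep hstab⟩
  -- the 2-periodic remainder
  obtain ⟨β, δ, hβδ⟩ := exists_eq_add_mul_neg_one_pow_of_periodic
    (fun n => C₀ + q * altSignSum n + (vv n : ℚ) / 12 - c n) (fun n hn => by
      simp only [altSignSum_add_two, hvv n hn, hc n hn])
  refine ⟨β, δ, fun n hn => ?_⟩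
  have h1 := hC n (by omega)
  have h2 := hβδ n (by omega)
  have h3 := hd n
  linear_combination h1 + h2 - h3

/-- **RATE TABLE (memo §2.3 CHECK, PROVED arithmetic):** the rate `α = 3A/2 − v/12` of `shaGrowth_fourParameter` is
`ℓ − v/12` for STAB's closed form `A = 2ℓ/3` (reducible `W[3]|G_{ℚ₃}`: `α = μ_w(τ)`), `ℓ + 1/8 − v/12` for the IRR shell
`A = 2ℓ/3 + 1/12` (`Σ 3^k/12 = (3^n − 1)/8`: `α = μ_w + 1/8 = 3/8`), and `ℓ + 1/2 − v/12` for the `j = 0` shell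
`A = 2ℓ/3 + 1/3` (one sign `+ 3^{k−1}`: `α = μ_w + 1/2`). [folklore] -/
theorem shaGrowthRate_table (ℓ v : ℚ) :
    3 * (2 * ℓ / 3) / 2 - v / 12 = ℓ - v / 12 ∧
      3 * (2 * ℓ / 3 + 1 / 12) / 2 - v / 12 = ℓ + 1 / 8 - v / 12 ∧
      3 * (2 * ℓ / 3 + 1 / 3) / 2 - v / 12 = ℓ + 1 / 2 - v / 12 := by
  refine ⟨by ring, by ring, by ring⟩

/-- `μ_w(τ) := ℓ(τ) − v/12` on the cyclic class B (`v₃N = 4`) is GEN 3's `m(v)/6 ∈ {1/6, 1/3}` (`kodairaOffset_sub_eq`,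
`cellLevel_four_eq_kodairaOffset`): `(4,II) 1/6 · (4,IV) 1/3 · (4,IV*) 1/6 · (4,II*) 1/3` — the reducible rates of memo
§2.2 on class B ("`α = μ_w(τ) ∈ {1/12, 1/6, 1/4, 1/3}`" across the three classes). [folklore] -/
theorem rate_classB_values :
    cellLevel 4 .II - (4 : ℚ) / 12 = 1 / 6 ∧ cellLevel 4 .IV - (6 : ℚ) / 12 = 1 / 3 ∧
      cellLevel 4 .IVstar - (10 : ℚ) / 12 = 1 / 6 ∧ cellLevel 4 .IIstar - (12 : ℚ) / 12 = 1 / 3 := by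
  simp only [cellLevel, newPoleOrder, sixNewPoleOrder, sixNewPoleOrderB]
  norm_num

/-! ### The dictionary over the INTERFACES: (G) ⟸ STAB + (F) + (D) + (C) + 3-BSD bookkeeping -/

section OverInterfaces

variable (real : ∀ (W : WeierstrassCurve ℚ) [W.IsElliptic] [W.IsGloballyMinimal], SignedFloorDatum W → Prop)
variable (realT : ∀ (W : WeierstrassCurve ℚ) [W.IsElliptic] [W.IsGloballyMinimal], LocalTowerDatum W → Prop)

/-- **3-BSD TOWER BOOKKEEPING (hypothesis SCHEMA, memo §1 COROLLARY; NOT a conjecture node of this lane and NEVER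
asserted — it is the quotient of the `3`-parts of BSD(`W/k_k`) and BSD(`W/k_{k−1}`) in o6-r1's normalisation).** For
`k ≥ k₁`: the even `χ`-part at layer `k` does not vanish, its valuation is `ν_k` (`D.nu k true = some (ν k)`), and
`e_k − e_{k−1} = φ(3^k)·ν_k − (d_k − d_{k−1}) − (ord₃c_k − ord₃c_{k−1}) − r`, where `e_n` stands for `ord₃ #Ш(W/k_n)[3^∞]`,
`r` for the (constant) Mordell–Weil rank along the tower, `d_n`, `c_n` are the tower datum's. The island table of memo §0 (i)
(1 232 / 1 232 predicted steps `S_k ∈ 2ℤ_{≥0}`, `k ≤ 6`) is this schema's output; here it is only NAMED. [folklore] -/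
def ThreeBSDTowerBookkeeping {W : WeierstrassCurve ℚ} [W.IsElliptic] [W.IsGloballyMinimal]
    (e ν : ℕ → ℚ) (D : SignedFloorDatum W) (T : LocalTowerDatum W) (r : ℚ) (k₁ : ℕ) : Prop :=
  ∀ k, k₁ ≤ k → D.nu k true = some (ν k) ∧
    e k - e (k - 1) = (phiThree k : ℚ) * ν k - (T.dAt k - T.dAt (k - 1)) -
      ((T.tamOrdAt k : ℚ) - (T.tamOrdAt (k - 1) : ℚ)) - r

/-- Under STAB the even analytic position is eventually CONSTANT along a non-vanishing tail: `a⁺_k = a⁺_{k₀}` for all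
`k ≥ k₀` (PROVED bookkeeping: iterate `AnalyticStabilityLawThree`). [folklore] -/
theorem analyticPos_eq_of_stability (hS : AnalyticStabilityLawThree real)
    (W : WeierstrassCurve ℚ) [W.IsElliptic] [W.IsGloballyMinimal] (D : SignedFloorDatum W) (hO : ClassO6 W 3)
    (hD : real W D) (hsurj : W.HasSurjectiveModNGaloisRep 3) (hred : D.shape ≠ .IRR) (hj : W.j ≠ 0)
    (ν : ℕ → ℚ) (k₁ : ℕ) (hnu : ∀ k, k₁ ≤ k → D.nu k true = some (ν k)) :
    ∃ k₀, k₁ ≤ k₀ ∧ ∀ k, k₀ ≤ k → analyticPos W k (ν k) = analyticPos W k₀ (ν k₀) := by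
  obtain ⟨k₀, hk₀⟩ := hS W D hO hD hsurj hred hj true
  refine ⟨max k₀ k₁, le_max_right _ _, fun k hk => ?_⟩
  induction k, hk using Nat.le_induction with
  | base => rfl
  | succ k hk ih =>
      rw [← ih]
      exact hk₀ k (ν k) (ν (k + 1)) (le_trans (le_max_left _ _) hk)
        (hnu k (le_trans (le_max_right _ _) hk)) (hnu (k + 1) (le_trans (le_max_right _ _) (Nat.le_succ_of_le hk)))

/-- **LAW (G) FROM STAB + (F) + (D) + (C) + 3-BSD BOOKKEEPING (memo §2.3 "DICTIONARY (why (G) carries no independent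
content)", PROVED).** For `W ∈ O6` (`v₃(N) ∈ {3,4,5}` explicit) with SURJECTIVE mod-3 image, `W[3]|G_{ℚ₃}` REDUCIBLE and
`j(W) ≠ 0`, data `D` (signed floor datum) and `T` (local tower datum): if STAB, (F), (D), (C) hold and the 3-BSD
bookkeeping schema holds from some layer on, then `e_n = (ℓ(τ) − v₃(Δ_min)/12)·3^n + γ·n + β + δ·(−1)^n` for all large
`n` — the four-parameter law (G) with RATE `α = μ_w(τ) := ℓ(τ) − v/12` EXACTLY (`ℓ = cellLevel (v₃N) (Kod₃)`), and
`γ = b⁺(W) − r` with `b⁺ = a⁺_{k₀}` the stabilised analytic position. Hence memo §2.2's fitted `α = μ_w(τ)` on the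
reducible classes (100 %) is a CONSEQUENCE of STAB and the local laws, not a further conjecture. [folklore] -/
theorem shaGrowthLaw_of_stability_of_towerLaws (hS : AnalyticStabilityLawThree real)
    (hF : CondExpTowerLawThree realT) (hDlaw : DiscriminantTowerLawThree realT) (hC : TamagawaTowerLawThree realT)
    (W : WeierstrassCurve ℚ) [W.IsElliptic] [W.IsGloballyMinimal] (D : SignedFloorDatum W) (T : LocalTowerDatum W)
    (hO : ClassO6 W 3) (hf : condExp W 3 = 3 ∨ condExp W 3 = 4 ∨ condExp W 3 = 5) (hD : real W D) (hT : realT W T)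
    (hsurj : W.HasSurjectiveModNGaloisRep 3) (hred : D.shape ≠ .IRR) (hj : W.j ≠ 0)
    (e ν : ℕ → ℚ) (r : ℚ) (k₁ : ℕ) (hbsd : ThreeBSDTowerBookkeeping e ν D T r k₁) :
    ∃ (k₂ : ℕ) (γ β δ : ℚ), ∀ n, k₂ ≤ n →
      e n = (cellLevel (condExp W 3) (W.kodairaSymbolAt (placeOf 3)) -
              (padicValInt 3 W.minimalDiscriminantInt : ℚ) / 12) * 3 ^ n + γ * n + β + δ * (-1) ^ n := by
  -- stabilisation of the even analytic position (STAB iterated along the non-vanishing tail)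
  obtain ⟨k₀, hk₀₁, hstab⟩ :=
    analyticPos_eq_of_stability real hS W D hO hD hsurj hred hj ν k₁ (fun k hk => (hbsd k hk).1)
  obtain ⟨b, hb⟩ : ∃ b : ℚ, ∀ k, k₀ ≤ k → analyticPos W k (ν k) = b := ⟨_, hstab⟩
  have hK1 : 1 ≤ max k₀ 1 := le_max_right _ _
  have hKk₀ : k₀ ≤ max k₀ 1 := le_max_left _ _
  -- closed form of the analytic valuations: φ(3^k)·ν_k = (2ℓ/3)·3^k + b
  have hclosed : ∀ k, max k₀ 1 ≤ k → (phiThree k : ℚ) * ν k =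
      2 * cellLevel (condExp W 3) (W.kodairaSymbolAt (placeOf 3)) / 3 * 3 ^ k + b + 0 * (-1) ^ k := by
    intro k hk
    have h := hb k (le_trans hKk₀ hk)
    unfold analyticPos at h
    have hφ := phiThree_eq_two_thirds_mul k (le_trans hK1 hk)
    linear_combination h + cellLevel (condExp W 3) (W.kodairaSymbolAt (placeOf 3)) * hφ
  -- the layer steps of the bookkeeping schema
  have hstep : ∀ k, max k₀ 1 ≤ k → e k - e (k - 1) = (phiThree k : ℚ) * ν k - (T.dAt k - T.dAt (k - 1)) -
      (((T.tamOrdAt k : ℕ) : ℚ) - ((T.tamOrdAt (k - 1) : ℕ) : ℚ)) - r :=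
    fun k hk => (hbsd k (le_trans hk₀₁ (le_trans hKk₀ hk))).2
  -- periodicity of v_n and of ord₃ c_n from (F), (D), (C)
  have hFW := hF W T hO hT
  have hvv : ∀ n, 1 ≤ n → T.valDiscAt (n + 2) = T.valDiscAt n := fun n hn =>
    (valDiscAt_add_two_eq W T n hn (condExpAt_add_two_eq W T hf hFW n hn) (hDlaw W T hO hT n hn)
      (hDlaw W T hO hT (n + 2) (by omega))).1
  have hcc : ∀ n, 1 ≤ n → ((T.tamOrdAt (n + 2) : ℕ) : ℚ) = ((T.tamOrdAt n : ℕ) : ℚ) := by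
    intro n hn
    simp only [LocalTowerDatum.tamOrdAt, hC W T hO hT n hn]
  obtain ⟨β, δ, hG⟩ := shaGrowth_fourParameter e ν (fun n => ((T.tamOrdAt n : ℕ) : ℚ)) T.valDiscAt
    (padicValInt 3 W.minimalDiscriminantInt) r
    (2 * cellLevel (condExp W 3) (W.kodairaSymbolAt (placeOf 3)) / 3) b 0 (max k₀ 1) hK1 T.dAt
    (fun n => rfl) hvv hcc hstep hclosed
  refine ⟨max k₀ 1, b - r, β, δ, fun n hn => ?_⟩
  rw [hG n hn]
  ring

end OverInterfaces

end Summit.BirchSwinnertonDyer.Rank1Residual.O6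

end
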